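import Mathlib.Analysis.Complex.Hadamard
import Mathlib.Analysis.Complex.Liouville
import Mathlib.Analysis.SpecialFunctions.Trigonometric.Deriv
import Literature.NumberTheory.LFunctions.DeBruijnNewmanProofs

/-!
# Spine/NE4/TwoConstantsFold — a ONE-SIDED two-constants bound for the derivative of a holomorphic function that is small on a real
# segment ending at the point (Hadamard three-lines through an entire fold map)

Cell `pub-balaban-gaps` (YM blitz G2), seat `ne4`, generation 6 (unit `pub-balaban-gaps-ne4-g6`); record `HOME/ne/NE4.md` §5 (R37).  The
complex-analysis engine of `Spine/NE4/FadingFromRateRealAnalytic` — the «two-constants theorem» that the headers of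
`Spine/NE4/FadingFromRateAnalytic` (R34) and `Spine/NE4/FadingFromRateAnalyticGap` (R36) name as the unformalised step for the REAL NE4 +
analyticity — kept in its own file so that the rung file stays below the size limit.

THE LEMMA (`norm_deriv_le_of_oneSided_right` ∕ `norm_deriv_le_of_oneSided_left`).  Let `Φ` be holomorphic on an open set containing the
closed disc of radius `s` about a real point `x`, `‖Φ z − Φ x‖ ≤ M` on the disc, and `‖Φ t − Φ x‖ ≤ ε` for REAL `t` in the ONE-SIDED segment
`[x, x+s]` (resp. `[x−s, x]`) only, `0 < ε ≤ M`.  Then `‖Φ′(x)‖ ≤ 2e³·ε·max(1, log(M∕ε))²∕s`.  With two-sided smallness the classical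
two-constants estimate (harmonic measure of a diameter) gives `ε·log(M∕ε)∕s` up to a constant; the SQUARE of the logarithm is the price of
one-sidedness (harmonic measure of a radius near its tip; extremal `cos(ω√(z−x))`), and one-sidedness is what the coupling box `]0,γ]`
forces near its ends.

THE PROOF (no harmonic measure, no conformal inverse).  The FOLD MAP `ψ(ζ) = x + a·sin²ζ`, `|a| = s∕e²`, is entire and EVEN, maps the real
axis into the segment between `x` and `x + a` (where `Φ − Φ(x)` is `ε`-small) and the closed strip `|Im ζ| ≤ 1` into the disc (where it is
`M`-bounded: `‖sin ζ‖ ≤ e^{|Im ζ|}`, the tree's `Literature.NumberTheory.LFunctions.norm_sin_le_exp_abs_im`, reused by import).  Hadamard's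
three-lines theorem (Mathlib `Complex.HadamardThreeLines.norm_le_interp_of_mem_verticalClosedStrip₀₁'`, on the strip rotated by `I`) bounds
`G = Φ∘ψ − Φ(x)` by `ε^{1−Im ζ}·M^{Im ζ}` for `0 ≤ Im ζ ≤ 1`, evenness transfers this to `Im ζ < 0`, so `‖G‖ ≤ e·ε` on the disc
`‖ζ‖ ≤ 1∕L`, `L = max(1, log(M∕ε))`; two Cauchy estimates (`Complex.norm_deriv_le_of_forall_mem_sphere_norm_le`, radius `1∕(2L)` each) give
`‖G″(0)‖ ≤ 4e·ε·L²`; and `G″(0) = 2a·Φ′(x)` because `ψ(0) = x`, `ψ′(0) = 0`, `ψ″(0) = 2a` (chain and product rules on the open strip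
`|Im ζ| < 1`, `Φ′` holomorphic there by `DifferentiableOn.deriv`).

HONEST FRAMING: elementary complex analysis ([folklore]: Nevanlinna's two-constants theorem in the one special geometry needed, obtained from
Hadamard's three-lines theorem as formalised in Mathlib); no object of Bałaban's appears in this file and nothing of Bałaban's is asserted; NE4
NOT IN PRINT, NOT PROVED; spine PROVED 0∕9 unchanged; NOT the continuum limit on ℝ⁴, NOT infinite volume, NOT a mass gap, NOT Clay.
-/

noncomputable section

namespace Summit.QuantumFields.BalabanUV.T4Continuum.Spine.NE4

open Set Metric Complex.HadamardThreeLines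

/-! ## §1 The fold map `ζ ↦ x + a·sin²ζ` from the strip `|Im ζ| ≤ 1` -/

/-- The FOLD MAP `foldMap x a ζ = x + a·sin²ζ`: entire, even, maps `ℝ` onto the real segment `[x, x+a]` and the closed strip
`|Im ζ| ≤ 1` into the closed disc of radius `a·e²` about `x`; `ψ(0) = x`, `ψ′(0) = 0`, `ψ″(0) = 2a`. [folklore] -/
def foldMap (x a : ℝ) (ζ : ℂ) : ℂ := (x : ℂ) + (a : ℂ) * Complex.sin ζ ^ 2

/-- The fold map is even. [folklore] -/
theorem foldMap_neg (x a : ℝ) (ζ : ℂ) : foldMap x a (-ζ) = foldMap x a ζ := by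
  simp [foldMap, Complex.sin_neg]

/-- `foldMap x a 0 = x`. [folklore] -/
theorem foldMap_zero (x a : ℝ) : foldMap x a 0 = x := by simp [foldMap]

/-- On the real line the fold map is real, with values in `[x, x + a]` (`a ≥ 0`). [folklore] -/
theorem foldMap_ofReal (x a t : ℝ) : foldMap x a (t : ℂ) = ((x + a * Real.sin t ^ 2 : ℝ) : ℂ) := by
  simp [foldMap, Complex.ofReal_sin]

/-- The real values `x + a·sin²t` of the fold map lie between `x` and `x + a`: right slit for `a ≥ 0` … [folklore] -/
theorem foldMap_real_mem_right {x a : ℝ} (ha : 0 ≤ a) (t : ℝ) :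
    x ≤ x + a * Real.sin t ^ 2 ∧ x + a * Real.sin t ^ 2 ≤ x + a := by
  have h1 : Real.sin t ^ 2 ≤ 1 := Real.sin_sq_le_one t
  constructor
  · nlinarith [sq_nonneg (Real.sin t)]
  · nlinarith

/-- … left slit for `a ≤ 0`. [folklore] -/
theorem foldMap_real_mem_left {x a : ℝ} (ha : a ≤ 0) (t : ℝ) :
    x + a ≤ x + a * Real.sin t ^ 2 ∧ x + a * Real.sin t ^ 2 ≤ x := by
  have h1 : Real.sin t ^ 2 ≤ 1 := Real.sin_sq_le_one t
  constructor
  · nlinarith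
  · nlinarith [sq_nonneg (Real.sin t)]

/-- On the closed strip `|Im ζ| ≤ 1` the fold map stays within `|a|·e²` of `x` (`‖sin ζ‖ ≤ e^{|Im ζ|}`, the tree's
`Literature.NumberTheory.LFunctions.norm_sin_le_exp_abs_im`). [folklore] -/
theorem norm_foldMap_sub_le (x a : ℝ) {ζ : ℂ} (hζ : |ζ.im| ≤ 1) : ‖foldMap x a ζ - x‖ ≤ |a| * Real.exp 2 := by
  have hsin : ‖Complex.sin ζ‖ ≤ Real.exp 1 :=
    (Literature.NumberTheory.LFunctions.norm_sin_le_exp_abs_im ζ).trans (Real.exp_le_exp.mpr hζ)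
  have h2 : ‖Complex.sin ζ‖ ^ 2 ≤ Real.exp 2 := by
    calc ‖Complex.sin ζ‖ ^ 2 ≤ Real.exp 1 ^ 2 := pow_le_pow_left₀ (norm_nonneg _) hsin 2
      _ = Real.exp 2 := by rw [← Real.exp_nat_mul]; norm_num
  have : foldMap x a ζ - x = (a : ℂ) * Complex.sin ζ ^ 2 := by simp [foldMap]
  rw [this, norm_mul, Complex.norm_real, Real.norm_eq_abs, norm_pow]
  exact mul_le_mul_of_nonneg_left h2 (abs_nonneg a)

/-- Derivative of the fold map: `ψ′(ζ) = a·2·sin ζ·cos ζ`. [folklore] -/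
theorem hasDerivAt_foldMap (x a : ℝ) (ζ : ℂ) :
    HasDerivAt (foldMap x a) ((a : ℂ) * (2 * (Complex.sin ζ * Complex.cos ζ))) ζ := by
  refine ((((Complex.hasDerivAt_sin ζ).fun_pow 2).const_mul (a : ℂ)).const_add (x : ℂ)).congr_deriv ?_
  rw [show ((2 : ℕ) : ℂ) * Complex.sin ζ ^ (2 - 1) = 2 * Complex.sin ζ by norm_num]
  ring

/-- Derivative of `ψ′`: `ζ ↦ a·2·sin ζ·cos ζ` has derivative `a·2·(cos²ζ − sin²ζ)`; at `0` this is `2a`. [folklore] -/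
theorem hasDerivAt_foldMap_deriv (a : ℝ) (ζ : ℂ) :
    HasDerivAt (fun y => (a : ℂ) * (2 * (Complex.sin y * Complex.cos y)))
      ((a : ℂ) * (2 * (Complex.cos ζ * Complex.cos ζ - Complex.sin ζ * Complex.sin ζ))) ζ := by
  refine ((((Complex.hasDerivAt_sin ζ).fun_mul (Complex.hasDerivAt_cos ζ)).const_mul (2 : ℂ)).const_mul
    (a : ℂ)).congr_deriv ?_
  ring

/-! ## §2 The one-sided two-constants bound on the derivative -/

/-- **TWO-CONSTANTS BOUND THROUGH THE FOLD MAP (core, either sign of `a`).**  Let `Φ` be holomorphic on an open set containing the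
closed disc of radius `s = |a|·e²` about a real point `x` (`a ≠ 0`), with `‖Φ z − Φ x‖ ≤ M` on that disc and `‖Φ ψ(t) − Φ x‖ ≤ ε` along
the REAL values `ψ(t) = x + a·sin²t` of the fold map only (these fill `[x, x+a]`, resp. `[x+a, x]`: ONE side of `x`), `0 < ε ≤ M`.  Then
`‖Φ′(x)‖ ≤ 2e³·ε·max(1, log(M∕ε))²∕s`.  Proof: `G = Φ ∘ ψ − Φ(x)` is holomorphic near the closed strip `|Im ζ| ≤ 1`, bounded by `M`
there and by `ε` on the real axis; Hadamard's three-lines theorem on the rotated strip (Mathlib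
`Complex.HadamardThreeLines.norm_le_interp_of_mem_verticalClosedStrip₀₁'`) and the evenness of `ψ` give `‖G ζ‖ ≤ ε·(M∕ε)^{|Im ζ|}`,
hence `≤ e·ε` on the disc `‖ζ‖ ≤ 1∕L`, `L = max(1, log(M∕ε))`; two Cauchy estimates (`Complex.norm_deriv_le_of_forall_mem_sphere_norm_le`)
give `‖G″(0)‖ ≤ 4e·ε·L²`, and `G″(0) = Φ′(x)·ψ″(0) = 2a·Φ′(x)` because `ψ′(0) = 0`.  The SQUARE of the logarithm is the price of the
one-sided smallness (the fold). [folklore] -/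
theorem norm_deriv_le_of_foldSmall {Φ : ℂ → ℂ} {U : Set ℂ} {x a M ε : ℝ} (ha0 : a ≠ 0) (hε : 0 < ε) (hεM : ε ≤ M)
    (hU : IsOpen U) (hsub : closedBall (x : ℂ) (|a| * Real.exp 2) ⊆ U) (hd : DifferentiableOn ℂ Φ U)
    (hM : ∀ z ∈ closedBall (x : ℂ) (|a| * Real.exp 2), ‖Φ z - Φ x‖ ≤ M)
    (hsmall : ∀ t : ℝ, ‖Φ ((x + a * Real.sin t ^ 2 : ℝ) : ℂ) - Φ x‖ ≤ ε) :
    ‖deriv Φ x‖ ≤ 2 * Real.exp 3 * ε * max 1 (Real.log (M / ε)) ^ 2 / (|a| * Real.exp 2) := by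
  set s : ℝ := |a| * Real.exp 2 with has
  have he2 : 0 < Real.exp 2 := Real.exp_pos 2
  have ha : 0 < |a| := abs_pos.mpr ha0
  have hs : 0 < s := mul_pos ha he2
  set ψ : ℂ → ℂ := foldMap x a with hψ_def
  set G : ℂ → ℂ := fun ζ => Φ (ψ ζ) - Φ x with hG_def
  -- the strip `|Im ζ| ≤ 1` is mapped into the closed disc
  have hψball : ∀ ζ : ℂ, |ζ.im| ≤ 1 → ψ ζ ∈ closedBall (x : ℂ) s := fun ζ hζ => by
    rw [mem_closedBall, dist_eq_norm]; exact norm_foldMap_sub_le x a hζ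
  have hGM : ∀ ζ : ℂ, |ζ.im| ≤ 1 → ‖G ζ‖ ≤ M := fun ζ hζ => hM _ (hψball ζ hζ)
  have hGε : ∀ t : ℝ, ‖G (t : ℂ)‖ ≤ ε := fun t => by
    show ‖Φ (foldMap x a t) - Φ x‖ ≤ ε
    rw [foldMap_ofReal]
    exact hsmall t
  have hGdiff : ∀ ζ : ℂ, |ζ.im| ≤ 1 → DifferentiableAt ℂ G ζ := fun ζ hζ => by
    have hΦ : DifferentiableAt ℂ Φ (ψ ζ) := hd.differentiableAt (hU.mem_nhds (hsub (hψball ζ hζ)))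
    exact (hΦ.comp ζ (hasDerivAt_foldMap x a ζ).differentiableAt).sub_const _
  have hGeven : ∀ ζ : ℂ, G (-ζ) = G ζ := fun ζ => by
    show Φ (foldMap x a (-ζ)) - Φ x = Φ (foldMap x a ζ) - Φ x
    rw [foldMap_neg]
  -- Hadamard three-lines on the rotated strip: `H z = G (I z)`, `0 ≤ re z ≤ 1`
  set H : ℂ → ℂ := fun z => G (Complex.I * z) with hH_def
  have hIim : ∀ z : ℂ, (Complex.I * z).im = z.re := fun z => by simp
  have hstrip : ∀ z ∈ verticalClosedStrip 0 1, |(Complex.I * z).im| ≤ 1 := fun z hz => by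
    have hz' : 0 ≤ z.re ∧ z.re ≤ 1 := by simpa [verticalClosedStrip] using hz
    rw [hIim, abs_of_nonneg hz'.1]; exact hz'.2
  have hHd : DiffContOnCl ℂ H (verticalStrip 0 1) := by
    apply DifferentiableOn.diffContOnCl
    have hcl : closure (verticalStrip 0 1) = verticalClosedStrip 0 1 := by
      rw [verticalStrip, Complex.closure_preimage_re, closure_Ioo zero_ne_one]; rfl
    rw [hcl]
    intro z hz
    exact ((hGdiff _ (hstrip z hz)).comp z ((differentiableAt_id.const_mul Complex.I))).differentiableWithinAt
  have hHB : BddAbove ((norm ∘ H) '' verticalClosedStrip 0 1) := by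
    refine ⟨M, ?_⟩
    rintro _ ⟨z, hz, rfl⟩
    exact hGM _ (hstrip z hz)
  have hHa : ∀ z ∈ Complex.re ⁻¹' ({0} : Set ℝ), ‖H z‖ ≤ ε := fun z hz => by
    have hz0 : z.re = 0 := by simpa using hz
    have hIz : Complex.I * z = ((-z.im : ℝ) : ℂ) := by
      apply Complex.ext <;> simp [hz0]
    show ‖G (Complex.I * z)‖ ≤ ε
    rw [hIz]; exact hGε _
  have hHb : ∀ z ∈ Complex.re ⁻¹' ({1} : Set ℝ), ‖H z‖ ≤ M := fun z hz => by
    have hz1 : z.re = 1 := by simpa using hz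
    exact hGM _ (by rw [hIim, hz1]; simp)
  have h3L : ∀ z ∈ verticalClosedStrip 0 1, ‖H z‖ ≤ ε ^ (1 - z.re) * M ^ z.re := fun z hz =>
    norm_le_interp_of_mem_verticalClosedStrip₀₁' H hz hHd hHB hHa hHb
  -- consequence in the ζ-plane: `‖G ζ‖ ≤ ε·(M/ε)^{Im ζ}` for `0 ≤ Im ζ ≤ 1`
  have hMε : 1 ≤ M / ε := by rwa [le_div_iff₀ hε, one_mul]
  have hGup : ∀ ζ : ℂ, 0 ≤ ζ.im → ζ.im ≤ 1 → ‖G ζ‖ ≤ ε * (M / ε) ^ ζ.im := fun ζ h0 h1 => by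
    set z : ℂ := -Complex.I * ζ with hz
    have hzre : z.re = ζ.im := by simp [hz]
    have hIz : Complex.I * z = ζ := by
      rw [hz, ← mul_assoc, mul_neg, Complex.I_mul_I, neg_neg, one_mul]
    have hzmem : z ∈ verticalClosedStrip 0 1 := by
      simpa [verticalClosedStrip, hzre] using And.intro h0 h1
    have h := h3L z hzmem
    rw [show H z = G ζ from by simp [hH_def, hIz], hzre] at h
    refine h.trans (le_of_eq ?_)
    rw [Real.rpow_sub hε, Real.rpow_one, Real.div_rpow (hε.le.trans hεM) hε.le]
    field_simp
  -- on the disc `‖ζ‖ ≤ τ`, `τ = 1/L`: `‖G ζ‖ ≤ e·ε`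
  set L : ℝ := max 1 (Real.log (M / ε)) with hL_def
  have hL1 : 1 ≤ L := le_max_left _ _
  have hL0 : 0 < L := lt_of_lt_of_le one_pos hL1
  set τ : ℝ := 1 / L with hτ_def
  have hτ0 : 0 < τ := by positivity
  have hτ1 : τ ≤ 1 := by rw [hτ_def, div_le_one hL0]; exact hL1
  have hpowτ : (M / ε) ^ τ ≤ Real.exp 1 := by
    rw [Real.rpow_def_of_pos (lt_of_lt_of_le one_pos hMε)]
    apply Real.exp_le_exp.mpr
    have hlog : Real.log (M / ε) ≤ L := le_max_right _ _
    calc Real.log (M / ε) * τ = Real.log (M / ε) / L := by rw [hτ_def]; ring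
      _ ≤ L / L := div_le_div_of_nonneg_right hlog hL0.le
      _ = 1 := div_self hL0.ne'
  have hGdisc : ∀ ζ : ℂ, ‖ζ‖ ≤ τ → ‖G ζ‖ ≤ ε * Real.exp 1 := by
    -- first for `Im ζ ≥ 0`, then by evenness
    have key : ∀ ζ : ℂ, ‖ζ‖ ≤ τ → 0 ≤ ζ.im → ‖G ζ‖ ≤ ε * Real.exp 1 := fun ζ hζ h0 => by
      have him : ζ.im ≤ τ := (le_abs_self _).trans ((Complex.abs_im_le_norm ζ).trans hζ)
      calc ‖G ζ‖ ≤ ε * (M / ε) ^ ζ.im := hGup ζ h0 (him.trans hτ1)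
        _ ≤ ε * (M / ε) ^ τ := mul_le_mul_of_nonneg_left (Real.rpow_le_rpow_of_exponent_le hMε him) hε.le
        _ ≤ ε * Real.exp 1 := mul_le_mul_of_nonneg_left hpowτ hε.le
    intro ζ hζ
    rcases le_or_gt 0 ζ.im with h0 | h0
    · exact key ζ hζ h0
    · rw [← hGeven ζ]
      exact key (-ζ) (by rwa [norm_neg]) (by simp; exact h0.le)
  -- first Cauchy estimate: `‖G′‖ ≤ 2eε/τ` on the sphere of radius `τ/2`
  have hτ2 : 0 < τ / 2 := by positivity
  have hD1 : ∀ ζ₁ ∈ sphere (0 : ℂ) (τ / 2), ‖deriv G ζ₁‖ ≤ ε * Real.exp 1 / (τ / 2) := fun ζ₁ hζ₁ => by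
    have hζ₁n : ‖ζ₁‖ = τ / 2 := by simpa using hζ₁
    have hdc : DiffContOnCl ℂ G (ball ζ₁ (τ / 2)) := by
      apply DifferentiableOn.diffContOnCl
      rw [closure_ball ζ₁ hτ2.ne']
      intro w hw
      refine (hGdiff w ?_).differentiableWithinAt
      have hwn : ‖w‖ ≤ τ := by
        have h1 : ‖w - ζ₁‖ ≤ τ / 2 := by rwa [mem_closedBall, dist_eq_norm] at hw
        calc ‖w‖ = ‖(w - ζ₁) + ζ₁‖ := by ring_nf
          _ ≤ ‖w - ζ₁‖ + ‖ζ₁‖ := norm_add_le _ _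
          _ ≤ τ / 2 + τ / 2 := add_le_add h1 hζ₁n.le
          _ = τ := by ring
      exact (Complex.abs_im_le_norm w).trans (hwn.trans hτ1)
    refine Complex.norm_deriv_le_of_forall_mem_sphere_norm_le hτ2 hdc fun w hw => hGdisc w ?_
    have h1 : ‖w - ζ₁‖ = τ / 2 := by simpa [dist_eq_norm] using hw
    calc ‖w‖ = ‖(w - ζ₁) + ζ₁‖ := by ring_nf
      _ ≤ ‖w - ζ₁‖ + ‖ζ₁‖ := norm_add_le _ _
      _ = τ := by rw [h1, hζ₁n]; ring
  -- second Cauchy estimate at `0`: `‖G″(0)‖ ≤ 4eε/τ²`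
  set S : Set ℂ := {ζ : ℂ | |ζ.im| < 1} with hS_def
  have hSopen : IsOpen S := isOpen_lt (continuous_abs.comp Complex.continuous_im) continuous_const
  have hGS : DifferentiableOn ℂ G S := fun ζ hζ => (hGdiff ζ (le_of_lt hζ)).differentiableWithinAt
  have hG'S : DifferentiableOn ℂ (deriv G) S := hGS.deriv hSopen
  have hballS : closedBall (0 : ℂ) (τ / 2) ⊆ S := fun w hw => by
    have hwn : ‖w‖ ≤ τ / 2 := by simpa using hw
    show |w.im| < 1
    exact lt_of_le_of_lt ((Complex.abs_im_le_norm w).trans hwn) (by linarith)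
  have hD2 : ‖deriv (deriv G) 0‖ ≤ ε * Real.exp 1 / (τ / 2) / (τ / 2) :=
    Complex.norm_deriv_le_of_forall_mem_sphere_norm_le hτ2 (hG'S.diffContOnCl_ball hballS) hD1
  -- `G″(0) = Φ′(x)·ψ″(0) = Φ′(x)·2a`
  have hGderiv : ∀ ζ ∈ S,
      HasDerivAt G (deriv Φ (ψ ζ) * ((a : ℂ) * (2 * (Complex.sin ζ * Complex.cos ζ)))) ζ := fun ζ hζ => by
    have hΦ : HasDerivAt Φ (deriv Φ (ψ ζ)) (ψ ζ) :=
      (hd.differentiableAt (hU.mem_nhds (hsub (hψball ζ (le_of_lt hζ))))).hasDerivAt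
    exact (hΦ.comp ζ (hasDerivAt_foldMap x a ζ)).sub_const _
  have h0S : (0 : ℂ) ∈ S := by simp [hS_def]
  have hDG : deriv G =ᶠ[nhds 0] fun ζ => deriv Φ (ψ ζ) * ((a : ℂ) * (2 * (Complex.sin ζ * Complex.cos ζ))) := by
    filter_upwards [hSopen.mem_nhds h0S] with ζ hζ
    exact (hGderiv ζ hζ).deriv
  have hψ0 : ψ 0 = x := by rw [hψ_def, foldMap_zero]
  have hΦ'diff : DifferentiableAt ℂ (deriv Φ) (ψ 0) :=
    (hd.deriv hU).differentiableAt (hU.mem_nhds (hsub (hψball 0 (by simp))))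
  have hprod := (hΦ'diff.hasDerivAt.comp 0 (hasDerivAt_foldMap x a 0)).mul (hasDerivAt_foldMap_deriv a 0)
  have hG'' : deriv (deriv G) 0 = deriv Φ x * (2 * (a : ℂ)) := by
    rw [(hprod.congr_of_eventuallyEq hDG).deriv]
    simp only [Function.comp_apply, hψ0, Complex.sin_zero, Complex.cos_zero]
    ring
  have hnorm : ‖deriv (deriv G) 0‖ = ‖deriv Φ x‖ * (2 * |a|) := by
    rw [hG'', norm_mul, show (2 : ℂ) * (a : ℂ) = ((2 * a : ℝ) : ℂ) by push_cast; ring, Complex.norm_real,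
      Real.norm_eq_abs, abs_mul, abs_two]
  have hfinal : ‖deriv Φ x‖ * (2 * |a|) ≤ 4 * (ε * Real.exp 1) * L ^ 2 := by
    rw [← hnorm]
    refine hD2.trans (le_of_eq ?_)
    rw [hτ_def]
    field_simp
    ring
  -- conclude: `2|a| = 2s/e²`
  have he3 : Real.exp 3 = Real.exp 1 * Real.exp 2 := by rw [← Real.exp_add]; norm_num
  rw [le_div_iff₀ hs]
  calc ‖deriv Φ x‖ * s = ‖deriv Φ x‖ * (2 * |a|) * (Real.exp 2 / 2) := by rw [has]; ring
    _ ≤ 4 * (ε * Real.exp 1) * L ^ 2 * (Real.exp 2 / 2) := mul_le_mul_of_nonneg_right hfinal (by positivity)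
    _ = 2 * Real.exp 3 * ε * L ^ 2 := by rw [he3]; ring

/-- **ONE-SIDED TWO-CONSTANTS BOUND, RIGHT SLIT.**  `Φ` holomorphic on an open set containing the closed disc of radius `s > 0` about the
real point `x`, `‖Φ z − Φ x‖ ≤ M` on the disc, `‖Φ t − Φ x‖ ≤ ε` for REAL `t ∈ [x, x + s]` (`0 < ε ≤ M`) ⟹
`‖Φ′(x)‖ ≤ 2e³·ε·max(1, log(M∕ε))²∕s` (`norm_deriv_le_of_foldSmall` with `a = s∕e²`). [folklore] -/
theorem norm_deriv_le_of_oneSided_right {Φ : ℂ → ℂ} {U : Set ℂ} {x s M ε : ℝ} (hs : 0 < s) (hε : 0 < ε) (hεM : ε ≤ M)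
    (hU : IsOpen U) (hsub : closedBall (x : ℂ) s ⊆ U) (hd : DifferentiableOn ℂ Φ U)
    (hM : ∀ z ∈ closedBall (x : ℂ) s, ‖Φ z - Φ x‖ ≤ M)
    (hsmall : ∀ t : ℝ, x ≤ t → t ≤ x + s → ‖Φ t - Φ x‖ ≤ ε) :
    ‖deriv Φ x‖ ≤ 2 * Real.exp 3 * ε * max 1 (Real.log (M / ε)) ^ 2 / s := by
  have he2 : 0 < Real.exp 2 := Real.exp_pos 2
  set a : ℝ := s / Real.exp 2 with ha_def
  have ha : 0 < a := div_pos hs he2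
  have has : |a| * Real.exp 2 = s := by rw [abs_of_pos ha]; exact div_mul_cancel₀ s he2.ne'
  have hale : a ≤ s := by
    rw [← has, abs_of_pos ha]; exact le_mul_of_one_le_right ha.le (Real.one_le_exp (by norm_num))
  rw [← has] at hsub hM ⊢
  exact norm_deriv_le_of_foldSmall ha.ne' hε hεM hU hsub hd hM fun t =>
    have hmem := foldMap_real_mem_right (x := x) ha.le t
    hsmall _ hmem.1 (hmem.2.trans (by linarith))

/-- **ONE-SIDED TWO-CONSTANTS BOUND, LEFT SLIT** (smallness for real `t ∈ [x − s, x]`; `a = −s∕e²`). [folklore] -/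
theorem norm_deriv_le_of_oneSided_left {Φ : ℂ → ℂ} {U : Set ℂ} {x s M ε : ℝ} (hs : 0 < s) (hε : 0 < ε) (hεM : ε ≤ M)
    (hU : IsOpen U) (hsub : closedBall (x : ℂ) s ⊆ U) (hd : DifferentiableOn ℂ Φ U)
    (hM : ∀ z ∈ closedBall (x : ℂ) s, ‖Φ z - Φ x‖ ≤ M)
    (hsmall : ∀ t : ℝ, x - s ≤ t → t ≤ x → ‖Φ t - Φ x‖ ≤ ε) :
    ‖deriv Φ x‖ ≤ 2 * Real.exp 3 * ε * max 1 (Real.log (M / ε)) ^ 2 / s := by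
  have he2 : 0 < Real.exp 2 := Real.exp_pos 2
  set a : ℝ := -(s / Real.exp 2) with ha_def
  have ha : a < 0 := neg_neg_of_pos (div_pos hs he2)
  have has : |a| * Real.exp 2 = s := by rw [ha_def, abs_neg, abs_of_pos (div_pos hs he2)]; exact div_mul_cancel₀ s he2.ne'
  have hale : -s ≤ a := by
    rw [← has, abs_of_neg ha]; nlinarith [Real.one_le_exp (show (0:ℝ) ≤ 2 by norm_num)]
  rw [← has] at hsub hM ⊢
  exact norm_deriv_le_of_foldSmall ha.ne hε hεM hU hsub hd hM fun t =>
    have hmem := foldMap_real_mem_left (x := x) ha.le t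
    hsmall _ (by linarith [hmem.1]) hmem.2


end Summit.QuantumFields.BalabanUV.T4Continuum.Spine.NE4

end
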